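/-
COR-CM (cells pub-hodgecm / pub-hodgecm2, stage 2 of the Hodge ladder) — Δ2 BRIDGE, sublemma S1 AT THE PIN, DEFINITION-FREE HALF
(seat d2bridge-prove-1 g1): the `HcmPieces` field `admLiu : ∀ q, adm (dLiu q)` (`CorCM/D2Bridge/HcmPieces.lean`, S1 block) for the
model's admissibility predicate `adm := (·).IsReflexOfTypeG ι₁ Φ` (`HodgeCM.Model.LiuCMSide.IsReflexOfTypeG`, the pinned dictionary's
`adm i d := d.IsReflexOfTypeG ι₁ (line i).lineType`), proved ONCE for EVERY model CM record whose reflex data are the TREE reflex pair of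
`(L, Φ_μ)` at `ι₁` read in `M_μ` — `(K', Φ', M, k, τ) := (↥K*_μ, Ψ*_μ, M_μ, e_μ, M_μ ⊆ ℂ)` — whatever its abelian-variety half
`(A, ιA, θA, isRealisation, α, α_mem)` (the predicate does not read it).  So the pin may take `dLiu q` to be Liu's own datum on its principal
model with `α := q • α'` (named form: `CorCM/D2Bridge/HcmS1Pin.lean`; anonymous form: the witnesses of `exists_liuCMRecord_of_cmDatum`,
`CorCM/D2Bridge/HcmS1LiuCMRecord.lean`) and discharge `admLiu` by THIS theorem either way.  Proof = R2
(`Transposition.isReflexOfType_of_reflexCMType`, `CorCM/B01/Transposition/Item6PinMatchReflexPairPkg.lean`) at `e := RingEquiv.refl`, `Def45.coe_incl`.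
Theorems only: no definition, no instance, no named fact; nothing landed is edited or restated.  FRAMING: HC_CM is NOT proved;
«Δ2 BRIDGE CLOSED» is NOT claimed; no pointer moves.
-/
import Summits.HodgeConjecture.CorCM.B01.Transposition.Item6PinMatchReflexPairPkg
import Literature.NumberTheory.Automorphic.Liu2021.Def45AsPrinted
import HarnessLib

set_option autoImplicit false

/-!
# Δ2 bridge, S1 at the pin (definition-free): admissibility of Liu's record shape

* `admLiu_mk` — for `L : HodgeCM.CMField` Galois over `ℚ`, the pin `ι₁`, a conjugate-symplectic `μ`, and ANY `(A, ιA, θA, hA, α, hα)` over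
  `M_μ = muAlgValueField L μ` realising the inflated reflex type `Ψ̃_μ = inducedCMType e_μ (reflexCMType ι₁ Φ_μ id)`: the record
  `⟨↥K*_μ, Ψ*_μ, M_μ, e_μ, A, ιA, θA, Ψ̃_μ, _, hA, (M_μ ⊆ ℂ), α, hα⟩ : LiuCMSide` satisfies `IsReflexOfTypeG ι₁ Φ_μ`;
* `admLiu_mk_of_eq` — the same at any `Φ' = Φ_μ` (X3-Char: `Φ_{μ_i} = (line i).lineType`).

References: Y. Liu, arXiv:2102.11518 = Camb. J. Math. 9 (2021), Def. 4.3 (2) (`FJcycle.tex` l. 1914–1921), Def. 4.5 (2) (l. 1944–1951);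
G. Shimura, *Abelian Varieties with Complex Multiplication and Modular Functions* (1998) §8.3 Prop. 28.  HC_CM is NOT proved.
-/

noncomputable section

open scoped TensorProduct

namespace Summit.HodgeConjecture.CorCM.D2Bridge

open CategoryTheory NumberField
open Literature.AlgebraicGeometry.Motives Literature.AlgebraicGeometry.HodgeTheory
open Literature.AlgebraicGeometry.ComplexMultiplication
open Literature.NumberTheory.ComplexMultiplication Literature.NumberTheory.Automorphic
open Literature.NumberTheory.Automorphic.IdeleClassGroup Literature.NumberTheory.Automorphic.PicardCM
open Literature.NumberTheory.Automorphic.Liu2021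
open HodgeCM.Model (LiuCMSide)

section Adm

variable {L : HodgeCM.CMField} [IsGalois ℚ L] (ι₁ : L →+* ℂ)
  {μ : Literature.NumberTheory.Automorphic.IdeleClassGroup L →ₜ* Circle} (hμ : IsConjugateSymplectic L μ)

/-- **S1 (law) at the pin, for every abelian-variety half.**  The model CM record with reflex data
`(K', Φ', M, k, τ) := (↥(reflexField ℚ L (algValuedIn ι₁ Φ_μ)), (reflexCMType ι₁ Φ_μ id).1, M_μ, e_μ, M_μ ⊆ ℂ)` and ANY
`(A, ιA, θA, isRealisation, α, α_mem)` of CM type the INFLATED REFLEX TYPE `Ψ̃_μ` is admissible for `Φ_μ` in the package sense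
`IsReflexOfTypeG ι₁ Φ_μ`: it presents the tree reflex pair on the nose (R2 at `e := RingEquiv.refl`, `Def45.coe_incl`).
[cite: Liu2021, Def. 4.3 (2) (FJcycle.tex l. 1919) and Def. 4.5 (2) (l. 1944–1951)] [cite: Shimura1998, §8.3 Prop. 28] -/
theorem admLiu_mk (A : AbelianVariety ℂ)
    (ιA : letI := hμ.numberField_muAlgValueField; 𝓞 ↥(muAlgValueField L μ) →+* End A)
    (θA : ↥(muAlgValueField L μ) →+* Module.End ℂ (complexBetti A.X 1))
    (hA : letI := hμ.numberField_muAlgValueField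
      IsCMTypeRealisation (inducedCMType (Def45.incl (AlgHom.id ℚ L) ι₁ hμ) (reflexCMType ι₁ hμ.cmType (AlgHom.id ℚ L))) A ιA θA)
    (α : ℂ ⊗[ℚ] bettiCohomology A.X 1)
    (hα : letI := hμ.numberField_muAlgValueField
      α ∈ eigenline (HodgeCM.CM.CommonReflex.complexify (BettiUniverse.cmAction θA hA.isInducedOnIntegers)) (muAlgValueField L μ).subtype) :
    ({ K' := ↥(reflexField ℚ L (algValuedIn ι₁ hμ.cmType.1))
       Φ' := (reflexCMType ι₁ hμ.cmType (AlgHom.id ℚ L)).1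
       M := ↥(muAlgValueField L μ)
       instNumberFieldM := hμ.numberField_muAlgValueField
       k := Def45.incl (AlgHom.id ℚ L) ι₁ hμ
       A := A, ιA := ιA, θA := θA
       ΦA := inducedCMType (Def45.incl (AlgHom.id ℚ L) ι₁ hμ) (reflexCMType ι₁ hμ.cmType (AlgHom.id ℚ L))
       hΦA := fun θ => mem_inducedCMType_iff _ _ θ
       isRealisation := hA
       τ := (muAlgValueField L μ).subtype
       α := α, α_mem := hα } : LiuCMSide).IsReflexOfTypeG ι₁ hμ.cmType := fun _ =>
  Transposition.isReflexOfType_of_reflexCMType ι₁ hμ.cmType _ (RingEquiv.refl _)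
    (RingHom.ext fun k => Def45.coe_incl (AlgHom.id ℚ L) ι₁ hμ k)
    (fun _ => Iff.of_eq (congrArg (fun χ => χ ∈ (reflexCMType ι₁ hμ.cmType (AlgHom.id ℚ L)).1) (RingHom.ext fun _ => rfl)))

/-- **… transported along a type identification `Φ_μ = Φ'`** (the pinned dictionary reads `adm` at `(line i).lineType = Φ_{μ_i}`, X3-Char).
[cite: Liu2021, Def. 4.3 (2) (FJcycle.tex l. 1919) and Def. 4.5 (2) (l. 1944–1951)] -/
theorem admLiu_mk_of_eq (A : AbelianVariety ℂ)
    (ιA : letI := hμ.numberField_muAlgValueField; 𝓞 ↥(muAlgValueField L μ) →+* End A)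
    (θA : ↥(muAlgValueField L μ) →+* Module.End ℂ (complexBetti A.X 1))
    (hA : letI := hμ.numberField_muAlgValueField
      IsCMTypeRealisation (inducedCMType (Def45.incl (AlgHom.id ℚ L) ι₁ hμ) (reflexCMType ι₁ hμ.cmType (AlgHom.id ℚ L))) A ιA θA)
    (α : ℂ ⊗[ℚ] bettiCohomology A.X 1)
    (hα : letI := hμ.numberField_muAlgValueField
      α ∈ eigenline (HodgeCM.CM.CommonReflex.complexify (BettiUniverse.cmAction θA hA.isInducedOnIntegers)) (muAlgValueField L μ).subtype)
    (Φ' : CMType L) (hΦ' : hμ.cmType = Φ') :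
    ({ K' := ↥(reflexField ℚ L (algValuedIn ι₁ hμ.cmType.1))
       Φ' := (reflexCMType ι₁ hμ.cmType (AlgHom.id ℚ L)).1
       M := ↥(muAlgValueField L μ)
       instNumberFieldM := hμ.numberField_muAlgValueField
       k := Def45.incl (AlgHom.id ℚ L) ι₁ hμ
       A := A, ιA := ιA, θA := θA
       ΦA := inducedCMType (Def45.incl (AlgHom.id ℚ L) ι₁ hμ) (reflexCMType ι₁ hμ.cmType (AlgHom.id ℚ L))
       hΦA := fun θ => mem_inducedCMType_iff _ _ θ
       isRealisation := hA
       τ := (muAlgValueField L μ).subtype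
       α := α, α_mem := hα } : LiuCMSide).IsReflexOfTypeG ι₁ Φ' := by
  subst hΦ'
  exact admLiu_mk ι₁ hμ A ιA θA hA α hα

end Adm

end Summit.HodgeConjecture.CorCM.D2Bridge

end
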